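import Literature.Geometry.Riemannian.ThreeShrinkerCompactDegenerate
import Literature.Geometry.Lorentzian.CoordNullRicciParallel
import HarnessLib

/-!
# Degenerate three-dimensional gradient solitons: the local parallel null field

The noncompact half of the classification of complete three-dimensional gradient shrinking Ricci
solitons (`threeShrinkerClassification_modelData`; Munteanu–Wang 2016, Thm. 1.2) splits, once
`Ric ≥ 0` is known (B.-L. Chen), into the case `Ric > 0` and the DEGENERATE case in which `Ric`
has a null vector somewhere. This file proves the local structure of the degenerate case:

* `ricci_null_everywhere_of_soliton` — on a connected three-dimensional gradient soliton with
  `Ric ≥ 0` and `S > 0`, if `Ric` has a null vector at one point it has one at every point (the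
  null set is open by `ricci_null_eventually_of_soliton` — E. Hopf's minimum principle for
  `det(♯Ric)` — and closed by `ricci_pos_eventually`);
* `MetricCoord.IsMetricOn.exists_null_eigenframe_of_null` — in a chart, at such a point the Ricci
  form has an orthonormal eigenframe of type `(0, S/2, S/2)` (the minimum-point dichotomy
  `ShrinkerPinchingEigenvalues` with `m = 0`);
* `MetricCoord.IsMetricOn.fderiv_scalAt_null_and_hessAt_null` — along a unit null field `v(S) = 0`
  and `Hess f(v,v) = λ` (so `S` is constant and `f'' = λ` along the null geodesics);
* **`exists_parallel_null_field_chart_of_soliton`** — hence, in the chart at any point `x₀`, the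
  chart components admit near `φ(x₀)` a smooth unit null field `v` of `Ric` with `∇v = 0`
  (`CoordNullRicciParallel.IsMetricOn.exists_parallel_null_field`: pure tensor calculus on the
  soliton, replacing Hamilton's strong maximum principle).

So such a soliton splits locally as a line times a surface; the global splitting, the
classification of the surface factor and the model data `(b)`, `(c)` of the fact are not treated
here. Everything is proved; no definitions are introduced.

## References

* O. Munteanu, J. Wang, arXiv:1606.01861, Thm. 1.2 (p. 3). [MunteanuWang2016]
* M. Eminenti, G. La Nave, C. Mantegazza, manuscripta math. 127 (2008), §3. [EminentiLanaveMantegazza2008]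
* R. S. Hamilton, J. Differential Geom. 24 (1986), Lemma 8.2. [Hamilton1986]
* P. Petersen, W. Wylie, Geom. Topol. 14 (2010), §3. [PetersenWylie2010]
-/

noncomputable section

set_option maxSynthPendingDepth 3

open Bundle Set Function Filter Module Metric
open scoped Manifold ContDiff Topology

namespace Literature.Geometry.Lorentzian

namespace MetricCoord

variable {E : Type*} [NormedAddCommGroup E] [NormedSpace ℝ E] [FiniteDimensional ℝ E]
  [CompleteSpace E] {G : E → E →L[ℝ] E →L[ℝ] ℝ} {V : Set E} {z : E}

/-- **The eigenframe of type `(0, S/2, S/2)` at a point with a null vector** of a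
three-dimensional gradient soliton with `Ric ≥ 0` and `S(z) > 0`, in coordinates.
[cite: EminentiLanaveMantegazza2008, §3 (p. 7)] -/
theorem IsMetricOn.exists_null_eigenframe_of_null (hG : IsMetricOn G V) (hz : z ∈ V)
    (h3 : finrank ℝ E = 3) (hpos : ∀ y ∈ V, ∀ w : E, w ≠ 0 → 0 < G y w w)
    {f : E → ℝ} {lam : ℝ} (hf : ContDiffOn ℝ ∞ f V)
    (hsol : ∀ y ∈ V, ∀ v w, ricAt G y v w + hessAt G f y v w = lam * G y v w)
    (hRic0 : ∀ y ∈ V, ∀ w, 0 ≤ ricAt G y w w) (hS : 0 < scalAt G z)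
    {v₀ : E} (hv₀ : v₀ ≠ 0) (hnull : ricAt G z v₀ v₀ = 0) :
    ∃ (e : Basis (Fin 3) ℝ E) (a : ℝ), a ≠ 0 ∧
      (∀ i j, G z (e i) (e j) = if i = j then 1 else 0) ∧
      ∀ i w, ricAt G z (e i) w = (if i = 0 then 0 else a) * G z (e i) w := by
  have hs := hG.symm z hz
  obtain ⟨e, μ, he, hμ, hs01, hs12⟩ := exists_sorted_eigenframe_three h3 hs (hpos z hz)
    (ricAt G z) (fun v w ↦ hG.ricAt_comm hz v w)
  have hdiag : ∀ i, ricAt G z (e i) (e i) = μ i := fun i ↦ by rw [hμ, he]; simp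
  have hμnn : ∀ i, 0 ≤ μ i := fun i ↦ by rw [← hdiag]; exact hRic0 z hz _
  -- `Ric(v₀, ·) = 0`, so `μ₀ = 0`
  have hRv : ∀ w, ricAt G z v₀ w = 0 :=
    Riemannian.clm_apply_eq_zero_of_nonneg_of_apply_self_eq_zero (fun v w ↦ hG.ricAt_comm hz v w)
      (hRic0 z hz) hnull
  have hμ00 : μ 0 = 0 := by
    have hcoef : ∀ i, μ i * G z v₀ (e i) = 0 := fun i ↦ by
      have h1 : ricAt G z (e i) v₀ = μ i * G z (e i) v₀ := hμ i v₀
      rw [hG.ricAt_comm hz, hRv, hs] at h1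
      exact h1.symm
    have hj : ∃ i, μ i = 0 := by
      by_contra hne
      push Not at hne
      have hc0 : ∀ i, G z v₀ (e i) = 0 := fun i ↦ (mul_eq_zero.mp (hcoef i)).resolve_left (hne i)
      apply hv₀
      rw [← sum_apply_smul_of_orthonormal e he v₀]
      simp [hc0]
    obtain ⟨i, hi⟩ := hj
    have hle : μ 0 ≤ μ i := by
      fin_cases i
      · exact le_rfl
      · exact hs01
      · exact hs01.trans hs12
    exact le_antisymm (hi ▸ hle) (hμnn 0)
  -- the dichotomy with `m = 0`
  have hminc : ∀ y ∈ V, ∀ w : E, 0 * scalAt G y * G y w w ≤ ricAt G y w w := fun y hy w ↦ by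
    rw [zero_mul, zero_mul]; exact hRic0 y hy w
  have heq0 : ricAt G z (e 0) (e 0) = 0 * scalAt G z * G z (e 0) (e 0) := by
    rw [hdiag, hμ00]; ring
  have hcases := hG.eigenvalues_at_pinching_minimum_three hz (hpos z hz) hf hsol e he hμ hminc heq0
    hs01 hs12 hS
  have hSsum : scalAt G z = μ 0 + μ 1 + μ 2 := by
    rw [scalAt_eq_sum_of_eigenframe e he hμ (hG.isInvertible z hz), Fin.sum_univ_three]
  have h12 : μ 1 = μ 2 := by
    rcases hcases with ⟨-, h⟩ | ⟨h01, h12⟩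
    · exact h
    · exact h12
  have hpos1 : 0 < μ 1 := by
    rcases hcases with ⟨-, h⟩ | ⟨h01, -⟩
    · nlinarith [hSsum, hμ00]
    · linarith [hSsum, hμ00, h01]
  refine ⟨e, μ 1, hpos1.ne', he, fun i w ↦ ?_⟩
  rw [hμ]
  congr 1
  fin_cases i
  · simp [hμ00]
  · simp
  · simp [h12]

/-- **Along a unit null field of a gradient soliton**: `v(S) = 0` (`dS = 2Ric(∇f,·)`) and
`Hess f(v,v) = λ` (the soliton equation with `Ric(v,v) = 0`, `G(v,v) = 1`) — so `S` is constant and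
`f'' = λ` along the (geodesic) integral curves of a parallel unit null field, the signature of the
cylinder `S² × ℝ` with `f = λt² + c`. [cite: EminentiLanaveMantegazza2008, §3]
[cite: PetersenWylie2010, §3] -/
theorem IsMetricOn.fderiv_scalAt_null_and_hessAt_null (hG : IsMetricOn G V) (hz : z ∈ V)
    {f : E → ℝ} {lam : ℝ} (hf : ContDiffOn ℝ ∞ f V)
    (hsol : ∀ y ∈ V, ∀ v w, ricAt G y v w + hessAt G f y v w = lam * G y v w)
    {v : E} (hunit : G z v v = 1) (hnull : ∀ Z, ricAt G z v Z = 0) :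
    fderiv ℝ (scalAt G) z v = 0 ∧ hessAt G f z v v = lam := by
  refine ⟨?_, ?_⟩
  · rw [hG.fderiv_scalAt_of_soliton hz hf hsol, hG.ricAt_comm hz, hnull, mul_zero]
  · have h := hsol z hz v v
    rw [hnull, hunit, zero_add, mul_one] at h
    exact h

end MetricCoord

end Literature.Geometry.Lorentzian

namespace Literature.Geometry.Riemannian

open Lorentzian Lorentzian.PseudoRiemannianMetric

variable {M : Type*} [TopologicalSpace M] [ChartedSpace (EuclideanSpace ℝ (Fin 3)) M]
  [IsManifold (𝓡 3) ∞ M]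
  (g : PseudoRiemannianMetric (𝓡 3) ∞ (EuclideanSpace ℝ (Fin 3)) (TangentSpace (𝓡 3) : M → Type _))
  [g.HasLeviCivita]

/-- **A null vector of `Ric` at one point forces one at every point** on a connected
three-dimensional gradient soliton with `Ric ≥ 0` and `S > 0` (the null set is open by E. Hopf's
minimum principle for `det(♯Ric)`, `ricci_null_eventually_of_soliton`, and closed by
`ricci_pos_eventually`). [cite: EminentiLanaveMantegazza2008, §3, p. 8] -/
theorem ricci_null_everywhere_of_soliton [ConnectedSpace M] (hg : g.IsRiemannian) {f : M → ℝ}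
    (hf : ContMDiff (𝓡 3) 𝓘(ℝ, ℝ) ∞ f) {lam : ℝ}
    (hsol : ∀ (x : M) (X Y : TangentSpace (𝓡 3) x),
      g.ricci x X Y + g.hessian f x X Y = lam * g.val x X Y)
    (hRic0 : ∀ (x : M) (w : TangentSpace (𝓡 3) x), 0 ≤ g.ricci x w w)
    (hS : ∀ x, 0 < g.scalarCurvature x) {p : M} {w₀ : TangentSpace (𝓡 3) p} (hw₀ : w₀ ≠ 0)
    (hnull : g.ricci p w₀ w₀ = 0) (x : M) :
    ∃ w : TangentSpace (𝓡 3) x, w ≠ 0 ∧ g.ricci x w w = 0 := by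
  set Z : Set M := {x | ∃ w : TangentSpace (𝓡 3) x, w ≠ 0 ∧ g.ricci x w w = 0} with hZ
  have hZo : IsOpen Z := by
    rw [isOpen_iff_mem_nhds]
    rintro y ⟨w, hw, hy⟩
    exact ricci_null_eventually_of_soliton g hg hf hsol hRic0 hS hw hy
  have hZc : IsClosed Z := by
    rw [← isOpen_compl_iff, isOpen_iff_mem_nhds]
    intro y hy
    have hpos : ∀ w : TangentSpace (𝓡 3) y, w ≠ 0 → 0 < g.ricci y w w := fun w hw ↦
      lt_of_le_of_ne (hRic0 y w) fun h0 ↦ hy ⟨w, hw, h0.symm⟩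
    filter_upwards [ricci_pos_eventually g y hpos] with y' hy'
    rintro ⟨w, hw, h0⟩
    exact (hy' w hw).ne' h0
  have hZu : Z = Set.univ := IsClopen.eq_univ ⟨hZc, hZo⟩ ⟨p, w₀, hw₀, hnull⟩
  have hx : x ∈ Z := by rw [hZu]; exact Set.mem_univ _
  exact hx

/-- **The local parallel null field of a degenerate three-dimensional gradient soliton, in a
chart.** On a connected three-dimensional gradient soliton `Ric + Hess f = λ g` with `Ric ≥ 0`,
`S > 0` and a null vector of `Ric` at some point, for every `x₀` the chart components
`G = chartRep` at `x₀` admit, on an open neighbourhood `U` of `φ(x₀)` in the chart target, a smooth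
field `v` with `G(v,v) = 1`, `Ric(v,·) = 0` and `Dv(X) + Γ(X,v) = 0` (a parallel unit null
field): the soliton splits locally as a line times a surface. The classical route is Hamilton's
strong maximum principle; here it is the tensor calculus of `CoordNullRicciParallel`.
[cite: EminentiLanaveMantegazza2008, §3] [cite: Hamilton1986, Lemma 8.2]
[cite: PetersenWylie2010, §3] [cite: MunteanuWang2016, Thm. 1.2 (p. 3)] -/
theorem exists_parallel_null_field_chart_of_soliton [ConnectedSpace M] (hg : g.IsRiemannian)
    {f : M → ℝ} (hf : ContMDiff (𝓡 3) 𝓘(ℝ, ℝ) ∞ f) {lam : ℝ}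
    (hsol : ∀ (x : M) (X Y : TangentSpace (𝓡 3) x),
      g.ricci x X Y + g.hessian f x X Y = lam * g.val x X Y)
    (hRic0 : ∀ (x : M) (w : TangentSpace (𝓡 3) x), 0 ≤ g.ricci x w w)
    (hS : ∀ x, 0 < g.scalarCurvature x) {p : M} {w₀ : TangentSpace (𝓡 3) p} (hw₀ : w₀ ≠ 0)
    (hnull : g.ricci p w₀ w₀ = 0) (x₀ : M) :
    ∃ U : Set (EuclideanSpace ℝ (Fin 3)), IsOpen U ∧ extChartAt (𝓡 3) x₀ x₀ ∈ U ∧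
      U ⊆ (extChartAt (𝓡 3) x₀).target ∧
      ∃ v : EuclideanSpace ℝ (Fin 3) → EuclideanSpace ℝ (Fin 3), ContDiffOn ℝ ∞ v U ∧
        (∀ z ∈ U, chartRep (𝓡 3) (fun _ ↦ g) x₀ 0 z (v z) (v z) = 1 ∧
          ∀ Z, MetricCoord.ricAt (chartRep (𝓡 3) (fun _ ↦ g) x₀ 0) z (v z) Z = 0) ∧
        ∀ z ∈ U, ∀ X, fderiv ℝ v z X +
          MetricCoord.chrAt (chartRep (𝓡 3) (fun _ ↦ g) x₀ 0) z X (v z) = 0 := by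
  have h3 : finrank ℝ (EuclideanSpace ℝ (Fin 3)) = 3 := finrank_euclideanSpace_fin
  -- the chart at `x₀`
  set G := chartRep (𝓡 3) (fun _ ↦ g) x₀ 0 with hGdef
  set T : Set (EuclideanSpace ℝ (Fin 3)) := (extChartAt (𝓡 3) x₀).target with hT
  have hGm : MetricCoord.IsMetricOn G T :=
    Lorentzian.OpensChart.isMetricOn_repr (val_chartPullback_eq_chartRep (fun _ : ℝ ↦ g) x₀ 0)
  have hGpos : ∀ y ∈ T, ∀ v : EuclideanSpace ℝ (Fin 3), v ≠ 0 → 0 < G y v v := by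
    intro y hy v hv
    rw [hGdef, show y = ((⟨y, hy⟩ : chartTarget (𝓡 3) x₀) : EuclideanSpace ℝ (Fin 3)) from rfl,
      chartRep_apply]
    exact chartPullback_pos g x₀ ⟨y, hy⟩ (fun w hw ↦ hg _ w hw) v hv
  have hu₀T : extChartAt (𝓡 3) x₀ x₀ ∈ T := mem_extChartAt_target x₀
  set fc : EuclideanSpace ℝ (Fin 3) → ℝ := f ∘ (extChartAt (𝓡 3) x₀).symm with hfc
  have hfcs : ContDiffOn ℝ ∞ fc T := by
    rw [hfc, ← contMDiffOn_iff_contDiffOn]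
    exact hf.comp_contMDiffOn (contMDiffOn_extChartAt_symm x₀)
  have hsolc := soliton_chartRep_target g x₀ hf hsol
  have hSpos : ∀ y ∈ T, 0 < MetricCoord.scalAt G y := fun y hy ↦ by
    rw [(Lorentzian.scalarCurvature_chartInv_eq g x₀ ⟨y, hy⟩).symm]; exact hS _
  have hRicc : ∀ y ∈ T, ∀ w : EuclideanSpace ℝ (Fin 3), 0 ≤ MetricCoord.ricAt G y w w := by
    intro y hy w
    have h := hRic0 (chartInv (𝓡 3) x₀ ⟨y, hy⟩)
      (mfderiv 𝓘(ℝ, EuclideanSpace ℝ (Fin 3)) (𝓡 3) (chartInv (𝓡 3) x₀) ⟨y, hy⟩ w)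
    rwa [ricci_chartInv_mfderiv_eq_ricAt] at h
  -- a null vector at every point of the chart
  have hnullc : ∀ y ∈ T, ∃ v₀ : EuclideanSpace ℝ (Fin 3), v₀ ≠ 0 ∧ MetricCoord.ricAt G y v₀ v₀ = 0 := by
    intro y hy
    obtain ⟨w, hw, hwn⟩ := ricci_null_everywhere_of_soliton g hg hf hsol hRic0 hS hw₀ hnull
      (chartInv (𝓡 3) x₀ ⟨y, hy⟩)
    set L := mfderiv 𝓘(ℝ, EuclideanSpace ℝ (Fin 3)) (𝓡 3) (chartInv (𝓡 3) x₀) ⟨y, hy⟩ with hL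
    have hinj : Function.Injective L := injective_mfderiv_chartInv (I := 𝓡 3) x₀ ⟨y, hy⟩
    have hinv := isInvertible_mfderiv_of_injective rfl hinj
    obtain ⟨v₀, rfl⟩ : ∃ v : EuclideanSpace ℝ (Fin 3), L v = w :=
      ⟨L.inverse w, by rw [← ContinuousLinearMap.comp_apply, hinv.self_comp_inverse]; rfl⟩
    have hv₀ : v₀ ≠ 0 := fun h0 ↦ hw (by subst h0; exact map_zero L)
    rw [hL, ricci_chartInv_mfderiv_eq_ricAt] at hwn
    exact ⟨v₀, hv₀, hwn⟩
  -- the type `(0, S/2, S/2)` everywhere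
  have hdeg : ∀ y ∈ T, ∃ (e : Basis (Fin 3) ℝ (EuclideanSpace ℝ (Fin 3))) (a : ℝ), a ≠ 0 ∧
      (∀ i j, G y (e i) (e j) = if i = j then 1 else 0) ∧
      ∀ i w, MetricCoord.ricAt G y (e i) w = (if i = 0 then 0 else a) * G y (e i) w := by
    intro y hy
    obtain ⟨v₀, hv₀, hvn⟩ := hnullc y hy
    exact hGm.exists_null_eigenframe_of_null hy h3 hGpos hfcs hsolc hRicc (hSpos y hy) hv₀ hvn
  obtain ⟨U, hUo, hyU, hUT, v, hvs, hvU, hpar⟩ :=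
    hGm.exists_parallel_null_field hu₀T hGpos hfcs hsolc hdeg
  exact ⟨U, hUo, hyU, hUT, v, hvs, hvU, hpar⟩

end Literature.Geometry.Riemannian

end
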